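import Literature.NumberTheory.Automorphic.QuaternionOrderUnitsCocompact
import Literature.NumberTheory.Automorphic.CuspFormRePeriodInjectiveArithmetic
import HarnessLib

/-!
# Injectivity of the weight-two real period map for `ι(O¹)`, `B ≅ M₂(ℚ)` (the cusped case):
# the residue (ESᶜ-inj-split) `eichlerShimura_weightTwo_rePeriod_injective_of_exists_not_isUnit` is a THEOREM

Topic `NumberTheory/Automorphic`; THEOREMS ONLY (no definition, no named fact, no instance, no notation, no `sorry`).
Filed by the BSD ideator seat `bsd-idea-10` (gen 22, lens = transfer) for the crux `EulerHalvesAtThree`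
(`stmt-BirchSwinnertonDyer-19109`), NUM node `CartanOnePlaceDegreeLawAtThree` (`stmt-BirchSwinnertonDyer-24801`), line of
record `Cruxes/CartanOnePlaceDegreeLawAtThree/Lines/lattice.lean`.  It DISCHARGES the named print residue
`Literature.NumberTheory.Automorphic.eichlerShimura_weightTwo_rePeriod_injective_of_exists_not_isUnit`
(`FuchsianEichlerShimuraWeightTwo.lean`: injectivity in Shimura Thm. 8.4 (`n = 0`) for `Γ = ι(O¹)` when `B` has a non-zero
non-unit, i.e. `B ≅ M₂(ℚ)` and `Γ` has cusps), so that — with `QuaternionOrderUnitsCocompact.lean` (division algebras) — the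
injectivity half of (ESᶜ) `eichlerShimura_weightTwo_rePeriod` is a theorem for EVERY `(B, O, ι)`, and (ESᶜ) follows from its
surjectivity residue ALONE (`eichlerShimura_weightTwo_rePeriod_of_surjective`).

HONEST FRAMING.  Nothing here proves a summit statement, the crux or the NUM node; (ESᶜ) itself still depends on the named
surjectivity residue `eichlerShimura_weightTwo_rePeriod_surjective` (Hodge theory on `Γ∖ℍ*`); the Birch–Swinnerton-Dyer
conjecture is proved for no curve.

## Contents (namespace `Literature.NumberTheory.Automorphic`)

* `CuspForm.eq_zero_of_forall_rePeriod_eq_zero_of_exists_not_isUnit` — for a quaternion algebra `B` over `ℚ` with a non-zero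
  non-unit, ANY order `O ⊆ B`, ANY `ℚ`-algebra map `ι : B → M₂(ℝ)` (injectivity of `ι` is not needed), ANY base point `z₀`:
  a weight-two cusp form on `Γ = normOneUnits ι hO = ι(O¹)` all of whose real periods `Re ∫_{z₀}^{γ z₀} F` vanish is zero.
* `eichlerShimura_weightTwo_rePeriod_injective_of_exists_not_isUnit_holds` — the residue, verbatim.
* `eichlerShimura_weightTwo_rePeriod_of_surjective`, `eichlerShimura_weightTwo_rePeriod_iff_surjective` — (ESᶜ) ⟺ (ESᶜ-surj).

PROOF (transfer of `QuaternionOrderUnitsCocompact.lean` §2 to the split side, then the cusped injectivity theorem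
`CuspForm.eq_zero_of_forall_rePeriod_eq_zero_of_isArithmetic` of `CuspFormRePeriodInjectiveArithmetic.lean`):
(1) normal form `B ≅ (a, b)_ℚ`, `a, b ∈ ℤ`, `a ≠ 0 < b`, and Skolem–Noether `ι ∘ f⁻¹ = h ρ(·) h⁻¹` (`h ∈ GL₂(ℝ)`); (2) a
non-zero non-unit makes `(a, b)_ℚ ≅ M₂(ℚ)` (Hodge lane `not_forall_isUnit_iff_nonempty_algEquiv`), so some conjugate
`h′ Γ_{a,b} h′⁻¹` of `Γ_{a,b} = ρ(𝔬¹)` is ARITHMETIC (Hodge lane `nonempty_algEquiv_iff_exists_isArithmetic_conj`, Bergeron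
Lemma 2.7), and so is `h′ Γ_{a,b}(N) h′⁻¹` for every `N ≥ 1` (`commensurable_congruenceUnitGroup`); replacing `h′` by
`diag(-1, 1)·h′` if necessary (`Subgroup.IsArithmetic.conj`), `det (h h′⁻¹) > 0`; (3) Jordan–Zassenhaus `N·𝔬 ⊆ f(O)` puts
`h Γ_{a,b}(N) h⁻¹ ≤ Γ = ι(O¹)` (Vignéras IV Prop. 1.4); (4) RESTRICT `F` to `h Γ_{a,b}(N) h⁻¹` and translate by `g = h h′⁻¹`:
`F ∣[2] g` is a weight-two cusp form for the arithmetic `det = 1` group `h′ Γ_{a,b}(N) h′⁻¹` whose real periods at `g⁻¹ z₀` are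
real periods of `F` at `z₀`, hence vanish; the cusped injectivity theorem gives `F ∣[2] g = 0`, so `F = 0`.

DEVIATIONS.  None of substance: step (1)+(3) is consumed BY NAME as the theorem
`exists_conj_congruenceUnitGroup_mem_normOneUnits` of `QuaternionOrderUnitsCocompact.lean` (Vignéras IV Prop. 1.4, the half
needed); the cusp analysis is entirely inside `CuspForm.eq_zero_of_forall_rePeriod_eq_zero_of_isArithmetic`.

## References

* [ShimuraIATAF1971] G. Shimura, *Introduction to the arithmetic theory of automorphic functions* (1971): §1.3 Prop. 1.31,
  §1.5, Thm. 8.4 p. 234, §9.2 p. 246 («Γ'∖ℌ is compact unless B is isomorphic to M₂(Q)»).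
* [VignerasLNM800] M.-F. Vignéras, *Arithmétique des algèbres de quaternions*, LNM 800 (1980): Ch. I §1; Ch. IV §1 Thm. 1.1
  p. 104, Prop. 1.4 p. 105.
* [Bergeron2016] N. Bergeron, *The Spectrum of Hyperbolic Surfaces* (2016), §2.2 Thm. 2.3, Lemma 2.7 pp. 36–42, §2.3.1 p. 44.
* [Voight2021] J. Voight, *Quaternion Algebras*, GTM 288, §7.7 Main Thm. 7.7.1, Cor. 7.7.4 (Skolem–Noether).
-/

set_option autoImplicit false

noncomputable section

open scoped MatrixGroups ModularForm Pointwise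

namespace Literature.NumberTheory.Automorphic

open Literature.Geometry.Kaehler.ComplexTorus
open Literature.Geometry.Kaehler.ComplexTorus.QuaternionType


/-! ### §1 In the split case an arithmetic `det = 1` group conjugates INTO `ι(O¹)` by a positive-determinant matrix -/

section Split

open scoped Quaternion
open ConjAct UpperHalfPlane

/-- `det = 1` is preserved under conjugation of the level. [folklore] -/
private theorem hasDetOne_conj_smul' {Γ : Subgroup (GL (Fin 2) ℝ)} (hΓ : Γ.HasDetOne) (x : GL (Fin 2) ℝ) :
    (toConjAct x • Γ).HasDetOne := by
  refine ⟨fun {g} hg => ?_⟩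
  obtain ⟨y, hy, rfl⟩ := (Subgroup.mem_smul_pointwise_iff_exists g _ _).mp hg
  haveI := hΓ
  rw [toConjAct_smul, map_mul, map_mul, map_inv, Subgroup.HasDetOne.det_eq hy, mul_one, mul_inv_cancel]

/-- Commensurability passes along `SL₂(ℝ) → GL₂(ℝ)`. [folklore] -/
private theorem commensurable_map_toGL' {H K : Subgroup SL(2, ℝ)} (h : Subgroup.Commensurable H K) :
    Subgroup.Commensurable (H.map (Matrix.SpecialLinearGroup.toGL : SL(2, ℝ) →* GL (Fin 2) ℝ))
      (K.map (Matrix.SpecialLinearGroup.toGL : SL(2, ℝ) →* GL (Fin 2) ℝ)) := by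
  refine ⟨?_, ?_⟩
  · rw [Subgroup.relIndex_map_map_of_injective _ _ Matrix.SpecialLinearGroup.toGL_injective]; exact h.1
  · rw [Subgroup.relIndex_map_map_of_injective _ _ Matrix.SpecialLinearGroup.toGL_injective]; exact h.2

/-- **Split case: an ARITHMETIC `det = 1` subgroup conjugates into `Γ = ι(O¹)` by a matrix of positive determinant.**
For `B ≅ (a, b)_ℚ ≅ M₂(ℚ)`: `h′ Γ_{a,b}(N) h′⁻¹` is arithmetic (Bergeron Lemma 2.7 + finite index), and
`(h h′⁻¹) · (h′ Γ_{a,b}(N) h′⁻¹) · (h h′⁻¹)⁻¹ = h Γ_{a,b}(N) h⁻¹ ≤ ι(O¹)` by Skolem–Noether and Jordan–Zassenhaus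
(Vignéras IV Prop. 1.4: the unit groups of two orders are commensurable).
[cite: ShimuraIATAF1971, §9.2 p. 246] [cite: Bergeron2016, §2.2 Lemma 2.7 p. 41 and §2.3.1 p. 44] [cite: VignerasLNM800, Ch. IV §1 Prop. 1.4 p. 105] -/
theorem exists_isArithmetic_conj_le_normOneUnits_of_exists_not_isUnit (B : Type*) [Ring B] [Algebra ℚ B]
    [IsQuaternionAlgebra ℚ B] (O : Submodule ℤ B) (hO : Brandt.IsOrder B O) (ι : B →ₐ[ℚ] Matrix (Fin 2) (Fin 2) ℝ)
    (hsplit : ∃ x : B, x ≠ 0 ∧ ¬ IsUnit x) :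
    ∃ (A : Subgroup (GL (Fin 2) ℝ)) (g : GL (Fin 2) ℝ), A.IsArithmetic ∧ A.HasDetOne ∧
      0 < (g.det : ℝ) ∧ toConjAct g • A ≤ normOneUnits ι hO := by
  classical
  -- (1) normal form, Skolem–Noether and Jordan–Zassenhaus: `h Γ_{a,b}(N) h⁻¹ ⊆ ι(O¹)` (`QuaternionOrderUnitsCocompact.lean`)
  obtain ⟨a, b, hb, f, h, N, ha, hN0, -, hmem⟩ := exists_conj_congruenceUnitGroup_mem_normOneUnits B O hO ι
  -- `(a, b)_ℚ` has a non-zero non-unit, too, hence `≅ M₂(ℚ)`, hence an arithmetic conjugate of `Γ_{a,b}`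
  have hQ : ¬ ∀ x : ℍ[ℚ,(a : ℚ),(b : ℚ)], x ≠ 0 → IsUnit x := by
    obtain ⟨x, hx0, hxu⟩ := hsplit
    intro hall
    apply hxu
    have hfx : f x ≠ 0 := fun h0 => hx0 (by simpa using congrArg f.symm h0)
    simpa using (hall (f x) hfx).map f.symm
  obtain ⟨h', hA'⟩ := (nonempty_algEquiv_iff_exists_isArithmetic_conj ha hb).mp
    ((not_forall_isUnit_iff_nonempty_algEquiv ha hb.ne').mp hQ)
  -- (2) the groups `U = Γ_{a,b}`, `C = Γ_{a,b}(N)` in `GL₂(ℝ)`; `C` is commensurable with `U` (Hodge lane, finite index)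
  set U : Subgroup (GL (Fin 2) ℝ) :=
    (unitGroup a b hb.le).map (Matrix.SpecialLinearGroup.toGL : SL(2, ℝ) →* GL (Fin 2) ℝ) with hUdef
  set C : Subgroup (GL (Fin 2) ℝ) :=
    (congruenceUnitGroup a b hb.le N).map (Matrix.SpecialLinearGroup.toGL : SL(2, ℝ) →* GL (Fin 2) ℝ) with hCdef
  have hCU : Subgroup.Commensurable C U := commensurable_map_toGL' (commensurable_congruenceUnitGroup ha hb hN0)
  have hC1 : C.HasDetOne := by rw [hCdef]; infer_instance
  -- (3) fix the sign of the determinant of the conjugator `h h₁⁻¹`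
  obtain ⟨h₁, hA₁, hdet⟩ : ∃ h₁ : GL (Fin 2) ℝ, (toConjAct h₁ • U).IsArithmetic ∧ 0 < ((h * h₁⁻¹).det : ℝ) := by
    rcases lt_or_gt_of_ne (Units.ne_zero (h * h'⁻¹).det) with hneg | hpos
    · -- replace `h'` by `J h'`, `J = diag(-1, 1) ∈ GL₂(ℚ)`
      let J : GL (Fin 2) ℚ := Matrix.GeneralLinearGroup.mkOfDetNeZero !![-1, 0; 0, 1]
        (by rw [Matrix.det_fin_two_of]; norm_num)
      haveI := hA'
      refine ⟨(Matrix.GeneralLinearGroup.map (Rat.castHom ℝ) J) * h', ?_, ?_⟩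
      · rw [map_mul, mul_smul]
        exact Subgroup.IsArithmetic.conj _ J
      · have hJ : ((Matrix.GeneralLinearGroup.map (Rat.castHom ℝ) J).det : ℝ) = -1 := by
          rw [Matrix.GeneralLinearGroup.val_det_apply]
          simp [J, Matrix.GeneralLinearGroup.mkOfDetNeZero, Matrix.det_fin_two]
        have e : ((h * ((Matrix.GeneralLinearGroup.map (Rat.castHom ℝ) J) * h')⁻¹).det : ℝ) =
            ((h * h'⁻¹).det : ℝ) * (((Matrix.GeneralLinearGroup.map (Rat.castHom ℝ) J).det : ℝ))⁻¹ := by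
          simp only [map_mul, map_inv, mul_inv_rev, Units.val_mul, Units.val_inv_eq_inv_val]
          ring
        rw [e, hJ]
        nlinarith
    · exact ⟨h', hA', hpos⟩
  refine ⟨toConjAct h₁ • C, h * h₁⁻¹, ?_, hasDetOne_conj_smul' hC1 h₁, hdet, ?_⟩
  · haveI := hA₁
    exact ⟨(hCU.conj (toConjAct h₁)).trans Subgroup.IsArithmetic.is_commensurable⟩
  · -- `(h h₁⁻¹) (h₁ C h₁⁻¹) (h h₁⁻¹)⁻¹ = h C h⁻¹ ≤ ι(O¹)`
    rw [← mul_smul, ← map_mul, inv_mul_cancel_right]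
    intro x hx
    obtain ⟨y, hy, rfl⟩ := (Subgroup.mem_smul_pointwise_iff_exists x _ _).mp hx
    rw [hCdef] at hy
    obtain ⟨g, hg, rfl⟩ := Subgroup.mem_map.mp hy
    rw [toConjAct_smul]
    exact hmem g hg

end Split

/-! ### §2 The residue (ESᶜ-inj-split) is a theorem -/

section Injectivity

open ConjAct UpperHalfPlane

/-- **INJECTIVITY IN SHIMURA Thm. 8.4 (`n = 0`) for `Γ = ι(O¹)`, `B ≅ M₂(ℚ)` (the case with cusps).**  For a quaternion
algebra `B` over `ℚ` with a non-zero non-unit, ANY order `O ⊆ B`, ANY `ℚ`-algebra map `ι : B → M₂(ℝ)` and ANY base point `z₀`: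
a weight-two cusp form on `normOneUnits ι hO` all of whose real periods `Re ∫_{z₀}^{γ z₀} F` vanish is zero.  Restrict `F` to the
conjugate `g A g⁻¹ ≤ ι(O¹)` of an arithmetic group `A` (§2), translate by `g`, and apply the cusped injectivity theorem
`CuspForm.eq_zero_of_forall_rePeriod_eq_zero_of_isArithmetic`. [cite: ShimuraIATAF1971, Thm. 8.4 p. 234 and §9.2 p. 246] -/
theorem CuspForm.eq_zero_of_forall_rePeriod_eq_zero_of_exists_not_isUnit (B : Type*) [Ring B] [Algebra ℚ B]
    [IsQuaternionAlgebra ℚ B] (O : Submodule ℤ B) (hO : Brandt.IsOrder B O) (ι : B →ₐ[ℚ] Matrix (Fin 2) (Fin 2) ℝ)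
    (hsplit : ∃ x : B, x ≠ 0 ∧ ¬ IsUnit x) (z₀ : ℍ) (F : CuspForm (normOneUnits ι hO) 2)
    (hF : ∀ γ : normOneUnits ι hO, CuspForm.rePeriod F z₀ γ = 0) : F = 0 := by
  obtain ⟨A, g, hA, hA1, hdet, hle⟩ :=
    exists_isArithmetic_conj_le_normOneUnits_of_exists_not_isUnit B O hO ι hsplit
  set Δ : Subgroup (GL (Fin 2) ℝ) := toConjAct g • A with hΔdef
  -- restriction of `F` to `Δ ≤ ι(O¹)`
  let Fr : CuspForm Δ 2 :=
    { toFun := F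
      slash_action_eq' := fun γ hγ => SlashInvariantForm.slash_action_eqn F γ (hle hγ)
      holo' := F.holo'
      zero_at_cusps' := fun hc => F.zero_at_cusps' (hc.mono hle) }
  have hFr : (⇑Fr : ℍ → ℂ) = ⇑F := rfl
  -- translate to the arithmetic level `g⁻¹ Δ g = A`
  have hlev : toConjAct g⁻¹ • Δ = A := by
    rw [hΔdef, ← mul_smul, ← map_mul, inv_mul_cancel, map_one, one_smul]
  haveI : (toConjAct g⁻¹ • Δ).IsArithmetic := by rw [hlev]; exact hA
  haveI : (toConjAct g⁻¹ • Δ).HasDetOne := by rw [hlev]; exact hA1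
  set G : CuspForm (toConjAct g⁻¹ • Δ) 2 := CuspForm.translate Fr g with hGdef
  have hcoeG : (⇑G : ℍ → ℂ) = (⇑F : ℍ → ℂ) ∣[(2 : ℤ)] g := rfl
  -- the real periods of `G` at `g⁻¹ z₀` are real periods of `F` at `z₀`
  have hG : ∀ δ : ↥(toConjAct g⁻¹ • Δ), CuspForm.rePeriod G (g⁻¹ • z₀) δ = 0 := by
    intro δ
    obtain ⟨y, hy, hyδ⟩ := (Subgroup.mem_smul_pointwise_iff_exists (δ : GL (Fin 2) ℝ) _ _).mp δ.2
    rw [CuspForm.rePeriod_apply, hcoeG, segmentIntegral_slash_eq F hdet]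
    have e1 : g • g⁻¹ • z₀ = z₀ := smul_inv_smul g z₀
    have e2 : g • (δ : GL (Fin 2) ℝ) • g⁻¹ • z₀ = y • z₀ := by
      rw [← hyδ, toConjAct_smul, smul_smul, smul_smul]
      congr 1
      group
    rw [e1, e2]
    have hp := hF ⟨y, hle hy⟩
    rwa [CuspForm.rePeriod_apply] at hp
  have hG0 : G = 0 := CuspForm.eq_zero_of_forall_rePeriod_eq_zero_of_isArithmetic (g⁻¹ • z₀) G hG
  have hF0 : (⇑F : ℍ → ℂ) = 0 := by
    have h2 : (⇑F : ℍ → ℂ) = ((⇑F : ℍ → ℂ) ∣[(2 : ℤ)] g) ∣[(2 : ℤ)] g⁻¹ := by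
      rw [← SlashAction.slash_mul, mul_inv_cancel, SlashAction.slash_one]
    rw [h2, ← hcoeG, hG0, CuspForm.coe_zero, SlashAction.zero_slash]
  exact DFunLike.coe_injective (hF0.trans CuspForm.coe_zero.symm)

/-- **THE RESIDUE (ESᶜ-inj-split) IS A THEOREM**: `eichlerShimura_weightTwo_rePeriod_injective_of_exists_not_isUnit`
(`FuchsianEichlerShimuraWeightTwo.lean`) holds — for every `(B, O, ι)` with `B ∌` only units (the hypothesis
`Function.Injective ι` of the residue is not even used). [cite: ShimuraIATAF1971, Thm. 8.4 p. 234 and §9.2 p. 246] -/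
theorem eichlerShimura_weightTwo_rePeriod_injective_of_exists_not_isUnit_holds :
    eichlerShimura_weightTwo_rePeriod_injective_of_exists_not_isUnit :=
  fun B _ _ _ O hO ι _ hsplit z₀ F hF =>
    CuspForm.eq_zero_of_forall_rePeriod_eq_zero_of_exists_not_isUnit B O hO ι hsplit z₀ F hF

/-- **(ESᶜ) FROM ITS SURJECTIVITY RESIDUE ALONE**: with both injectivity halves theorems
(`eichlerShimura_weightTwo_rePeriod_injective_of_forall_isUnit`, `…_of_exists_not_isUnit_holds`), the named fact
`eichlerShimura_weightTwo_rePeriod` (Shimura Thm. 8.4, `n = 0`, for every `Γ = ι(O¹)`) follows from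
`eichlerShimura_weightTwo_rePeriod_surjective`. [cite: ShimuraIATAF1971, Thm. 8.4 p. 234] -/
theorem eichlerShimura_weightTwo_rePeriod_of_surjective (hsurj : eichlerShimura_weightTwo_rePeriod_surjective) :
    eichlerShimura_weightTwo_rePeriod :=
  eichlerShimura_weightTwo_rePeriod_of_residue' eichlerShimura_weightTwo_rePeriod_injective_of_exists_not_isUnit_holds hsurj

/-- (ESᶜ) ⟺ (ESᶜ-surj): the print residue of (ESᶜ) is EXACTLY its surjectivity. [cite: ShimuraIATAF1971, Thm. 8.4 p. 234] -/
theorem eichlerShimura_weightTwo_rePeriod_iff_surjective :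
    eichlerShimura_weightTwo_rePeriod ↔ eichlerShimura_weightTwo_rePeriod_surjective :=
  ⟨fun h => h.surjective, eichlerShimura_weightTwo_rePeriod_of_surjective⟩

end Injectivity

end Literature.NumberTheory.Automorphic

end
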